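import Mathlib.NumberTheory.PrimeCounting
import Literature.NumberTheory.LFunctions.KaramataTauberian
import Literature.NumberTheory.LFunctions.PrimeReciprocalWindows
import HarnessLib

/-!
# A Tauberian theorem for sums over primes with bounded coefficients

Topic `Literature/NumberTheory/LFunctions`. Everything in this file is PROVED (no `sorry`).

**Theorem** (`Literature.NumberTheory.LFunctions.PrimeSum.tendsto_sum_primesLE_div`). Let `a : ℕ → ℝ` be bounded on the
primes, `|a p| ≤ B`, and suppose the "Dirichlet density" limit
`Σ_p a(p) p^{-s} → L` (`s → 1⁺`) exists. Then the ordered sum converges to the same value: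
`Σ_{p ≤ x} a(p)/p → L` (`x → ∞`).

This is the Hardy–Littlewood (Karamata) Tauberian theorem, Montgomery–Vaughan *Multiplicative
Number Theory I*, Theorem 5.11 with `α = β = 0`, for the generalized Dirichlet series
`Σ c_n n^{-δ}` with `c_p = a(p)/p` on primes: the Tauberian condition `c_n ≥ -B/n · 1_{prime}(n)`
("`a_n = O₋(1/n)` along the primes") is admissible because the weight `w(p) = 1/p` on primes
satisfies the two estimates of MV p. 124 by Chebyshev's bound alone
(`PrimeReciprocalWindows.lean`: `Σ_{2^j<p≤2^{j+1}} 1/p ≤ 4/j`). We feed these into the tree's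
proved Stieltjes-form Tauberian theorem `Literature.NumberTheory.LFunctions.HardyLittlewoodTauberianSums_holds`
(`KaramataTauberian.lean`, MV Thm. 5.7 run on sums, `λ_n = log n`), placing the constant `-L`
at `n = 1` (`λ_1 = 0`).

Typical use (the sibling file `DegreeOnePrimes.lean`, which lands after this one):
`a(p) = r_K(p) - 1` with `r_K(p)` the number of degree-one
primes of a number field `K` above `p`, where the Abelian limit comes from `log ζ_K(s)` at
`s = 1⁺`; this yields the convergence of `Σ_p (r_K(p) - 1)/p` without the prime ideal theorem.

## References

* H. L. Montgomery, R. C. Vaughan, *Multiplicative Number Theory I. Classical Theory*,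
  Cambridge Stud. Adv. Math. 97 (2007), §5.2, Theorems 5.7 and 5.11, pp. 123–126.
  [cite: MontgomeryVaughan2007, Thm. 5.11]
-/

noncomputable section

open Finset Real Filter
open scoped Topology

namespace Literature.NumberTheory.LFunctions

namespace PrimeSum

open PrimeReciprocal

variable {a : ℕ → ℝ} {B L : ℝ}

/-! ### The coefficient and weight sequences fed to the Tauberian theorem -/

/-- Coefficients: `c 1 = -L`, `c p = a p / p` for `p` prime, `0` otherwise. [folklore] -/
def coeff (a : ℕ → ℝ) (L : ℝ) (n : ℕ) : ℝ :=
  if n = 1 then -L else if n.Prime then a n / n else 0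

/-- The prime part of `coeff`: `a p / p` on primes, `0` elsewhere. [folklore] -/
def coeffP (a : ℕ → ℝ) (n : ℕ) : ℝ := if n.Prime then a n / n else 0

/-- The `n = 1` part of `coeff`. [folklore] -/
def coeffOne (L : ℝ) (n : ℕ) : ℝ := if n = 1 then -L else 0

/-- Weights: `w 1 = |L|`, `w p = B / p` for `p` prime, `0` otherwise. [folklore] -/
def weight (B L : ℝ) (n : ℕ) : ℝ := if n = 1 then |L| else B * invPrimeWeight n

/-- Auxiliary (proof-internal). [folklore] -/
lemma coeff_eq_add (a : ℕ → ℝ) (L : ℝ) (n : ℕ) : coeff a L n = coeffOne L n + coeffP a n := by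
  unfold coeff coeffOne coeffP
  by_cases h1 : n = 1
  · subst h1; simp [Nat.not_prime_one]
  · simp [h1]

/-- Auxiliary (proof-internal). [folklore] -/
lemma coeffP_of_prime {n : ℕ} (hn : n.Prime) : coeffP a n = a n / n := if_pos hn

/-- Auxiliary (proof-internal). [folklore] -/
lemma coeffP_of_not_prime {n : ℕ} (hn : ¬ n.Prime) : coeffP a n = 0 := if_neg hn

/-- Auxiliary (proof-internal). [folklore] -/
lemma abs_coeffP_le (ha : ∀ p : ℕ, p.Prime → |a p| ≤ B) (n : ℕ) :
    |coeffP a n| ≤ B * invPrimeWeight n := by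
  by_cases hn : n.Prime
  · rw [coeffP_of_prime hn, invPrimeWeight_of_prime hn, abs_div, Nat.abs_cast, mul_one_div]
    exact div_le_div_of_nonneg_right (ha n hn) (Nat.cast_nonneg n)
  · rw [coeffP_of_not_prime hn, invPrimeWeight_of_not_prime hn, abs_zero, mul_zero]

/-- Auxiliary (proof-internal). [folklore] -/
lemma nonneg_of_bound (ha : ∀ p : ℕ, p.Prime → |a p| ≤ B) : 0 ≤ B :=
  (abs_nonneg _).trans (ha 2 Nat.prime_two)

/-- Auxiliary (proof-internal). [folklore] -/
lemma weight_nonneg (ha : ∀ p : ℕ, p.Prime → |a p| ≤ B) (n : ℕ) : 0 ≤ weight B L n := by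
  unfold weight
  split_ifs
  · exact abs_nonneg L
  · exact mul_nonneg (nonneg_of_bound ha) (invPrimeWeight_nonneg n)

/-- The Tauberian condition `c_n ≥ -w_n`. [folklore] -/
lemma neg_weight_le_coeff (ha : ∀ p : ℕ, p.Prime → |a p| ≤ B) (n : ℕ) :
    -weight B L n ≤ coeff a L n := by
  rw [coeff_eq_add]
  unfold weight coeffOne
  by_cases h1 : n = 1
  · subst h1
    simp only [if_true, coeffP_of_not_prime Nat.not_prime_one, add_zero]
    exact neg_le_neg (le_abs_self L)
  · simp only [h1, if_false, zero_add]
    have := abs_coeffP_le ha n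
    rw [abs_le] at this
    exact this.1

/-! ### Summability of the damped series -/

/-- Auxiliary (proof-internal). [folklore] -/
lemma summable_coeffOne_mul (L : ℝ) (e : ℕ → ℝ) : Summable fun n => coeffOne L n * e n := by
  refine summable_of_ne_finset_zero (s := {1}) fun n hn => ?_
  rw [Finset.mem_singleton] at hn
  simp [coeffOne, hn]

/-- Auxiliary (proof-internal). [folklore] -/
lemma tsum_coeffOne_mul (L : ℝ) (e : ℕ → ℝ) : ∑' n, coeffOne L n * e n = -L * e 1 := by
  rw [tsum_eq_single 1 fun n hn => by simp [coeffOne, hn]]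
  simp [coeffOne]

/-- Auxiliary (proof-internal). [folklore] -/
lemma summable_coeffP_mul_exp (ha : ∀ p : ℕ, p.Prime → |a p| ≤ B) {δ : ℝ} (hδ : 0 < δ) :
    Summable fun n => coeffP a n * Real.exp (-(δ * Real.log n)) := by
  refine Summable.of_norm_bounded ((summable_invPrimeWeight_mul_exp hδ).mul_left B) fun n => ?_
  rw [Real.norm_eq_abs, abs_mul, abs_of_pos (Real.exp_pos _), ← mul_assoc]
  exact mul_le_mul_of_nonneg_right (abs_coeffP_le ha n) (Real.exp_pos _).le

/-- Auxiliary (proof-internal). [folklore] -/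
lemma summable_coeff_mul_exp (ha : ∀ p : ℕ, p.Prime → |a p| ≤ B) {δ : ℝ} (hδ : 0 < δ) :
    Summable fun n => coeff a L n * Real.exp (-(δ * Real.log n)) := by
  have : (fun n => coeff a L n * Real.exp (-(δ * Real.log n))) = fun n =>
      coeffOne L n * Real.exp (-(δ * Real.log n)) + coeffP a n * Real.exp (-(δ * Real.log n)) := by
    funext n; rw [coeff_eq_add, add_mul]
  rw [this]
  exact (summable_coeffOne_mul L _).add (summable_coeffP_mul_exp ha hδ)

/-- Auxiliary (proof-internal). [folklore] -/
lemma summable_weight_mul_exp (B L : ℝ) {δ : ℝ} (hδ : 0 < δ) :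
    Summable fun n => weight B L n * Real.exp (-(δ * Real.log n)) := by
  have : (fun n : ℕ => weight B L n * Real.exp (-(δ * Real.log n))) = fun n : ℕ =>
      (if n = 1 then |L| else 0) * Real.exp (-(δ * Real.log n)) +
        B * (invPrimeWeight n * Real.exp (-(δ * Real.log n))) := by
    funext n
    unfold weight
    by_cases h1 : n = 1
    · subst h1; simp [invPrimeWeight_of_not_prime Nat.not_prime_one]
    · simp [h1]; ring
  rw [this]
  refine Summable.add ?_ ((summable_invPrimeWeight_mul_exp hδ).mul_left B)
  refine summable_of_ne_finset_zero (s := {1}) fun n hn => ?_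
  rw [Finset.mem_singleton] at hn
  simp [hn]

/-! ### The damped series is the prime Dirichlet series shifted by `-L` -/

/-- For `p > 0`: `(a/p) e^{-δ log p} = a p^{-(1+δ)}`. [folklore] -/
lemma div_mul_exp_neg_mul_log {p : ℕ} (hp : 0 < p) (x δ : ℝ) :
    x / p * Real.exp (-(δ * Real.log p)) = x * (p : ℝ) ^ (-(1 + δ)) := by
  have hp0 : (0 : ℝ) < p := by exact_mod_cast hp
  have h1 : Real.exp (-(δ * Real.log p)) = (p : ℝ) ^ (-δ) := by
    rw [Real.rpow_def_of_pos hp0]; congr 1; ring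
  rw [h1, show -(1 + δ) = (-1) + (-δ) by ring, Real.rpow_add hp0, Real.rpow_neg_one]
  ring

/-- `Σ_n coeffP(n) e^{-δ log n} = Σ_p a(p) p^{-(1+δ)}`. [folklore] -/
lemma tsum_coeffP_mul_exp (a : ℕ → ℝ) (δ : ℝ) :
    ∑' n, coeffP a n * Real.exp (-(δ * Real.log n)) =
      ∑' p : Nat.Primes, a p * (p : ℝ) ^ (-(1 + δ)) := by
  have h1 : ∑' p : Nat.Primes, a p * (p : ℝ) ^ (-(1 + δ)) =
      ∑' n : ℕ, {p : ℕ | p.Prime}.indicator (fun n => a n * (n : ℝ) ^ (-(1 + δ))) n :=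
    tsum_subtype {p : ℕ | p.Prime} (fun n => a n * (n : ℝ) ^ (-(1 + δ)))
  rw [h1]
  refine tsum_congr fun n => ?_
  by_cases hn : n.Prime
  · rw [Set.indicator_of_mem (show n ∈ {p : ℕ | p.Prime} from hn), coeffP_of_prime hn,
      div_mul_exp_neg_mul_log hn.pos]
  · rw [Set.indicator_of_notMem (show n ∉ {p : ℕ | p.Prime} from hn), coeffP_of_not_prime hn,
      zero_mul]

/-- `Σ_n c_n e^{-δ log n} = -L + Σ_p a(p) p^{-(1+δ)}` for `δ > 0`. [folklore] -/
lemma tsum_coeff_mul_exp (ha : ∀ p : ℕ, p.Prime → |a p| ≤ B) {δ : ℝ} (hδ : 0 < δ) :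
    ∑' n, coeff a L n * Real.exp (-(δ * Real.log n)) =
      -L + ∑' p : Nat.Primes, a p * (p : ℝ) ^ (-(1 + δ)) := by
  have : (fun n => coeff a L n * Real.exp (-(δ * Real.log n))) = fun n =>
      coeffOne L n * Real.exp (-(δ * Real.log n)) + coeffP a n * Real.exp (-(δ * Real.log n)) := by
    funext n; rw [coeff_eq_add, add_mul]
  rw [this, (summable_coeffOne_mul L _).tsum_add (summable_coeffP_mul_exp ha hδ),
    tsum_coeffOne_mul, tsum_coeffP_mul_exp]
  simp

/-! ### The weight estimates E1, E2 for `weight B L` -/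

/-- Auxiliary (proof-internal): the `n = 1` terms never contribute. [folklore] -/
lemma weight_mul_kernel_eq (B L U : ℝ) (n : ℕ) :
    weight B L n * (Real.exp (-(Real.log n / U)) * (1 - Real.exp (-(Real.log n / U)))) =
      B * (invPrimeWeight n *
        (Real.exp (-(Real.log n / U)) * (1 - Real.exp (-(Real.log n / U))))) := by
  unfold weight
  by_cases h1 : n = 1
  · subst h1; simp
  · simp only [h1, if_false]; ring

/-- **E1** for `weight B L`: `Σ w_n e^{-log n/U}(1 - e^{-log n/U}) ≤ 17 B` for `U ≥ 1`.
[folklore] -/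
lemma tsum_weight_kernel_le (ha : ∀ p : ℕ, p.Prime → |a p| ≤ B) {U : ℝ} (hU : 1 ≤ U) :
    ∑' n, weight B L n * (Real.exp (-(Real.log n / U)) * (1 - Real.exp (-(Real.log n / U)))) ≤
      17 * B := by
  rw [show (fun n => weight B L n *
      (Real.exp (-(Real.log n / U)) * (1 - Real.exp (-(Real.log n / U))))) = fun n =>
      B * (invPrimeWeight n * (Real.exp (-(Real.log n / U)) * (1 - Real.exp (-(Real.log n / U)))))
      from funext (weight_mul_kernel_eq B L U), tsum_mul_left, mul_comm]
  exact mul_le_mul_of_nonneg_right (tsum_invPrimeWeight_karamata_le hU) (nonneg_of_bound ha)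

/-- Auxiliary (proof-internal): for `U > 0`, `ε < 1` the window misses `n = 1`. [folklore] -/
lemma weight_window_eq {ε U : ℝ} (hε : ε < 1) (hU : 0 < U) (n : ℕ) :
    (if (1 - ε) * U ≤ Real.log n ∧ Real.log n ≤ (1 + ε) * U then weight B L n else 0) =
      B * (if (1 - ε) * U ≤ Real.log n ∧ Real.log n ≤ (1 + ε) * U
        then invPrimeWeight n else 0) := by
  unfold weight
  by_cases h1 : n = 1
  · subst h1
    have : ¬ ((1 - ε) * U ≤ Real.log (1 : ℕ) ∧ Real.log (1 : ℕ) ≤ (1 + ε) * U) := by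
      rintro ⟨h, -⟩
      simp only [Nat.cast_one, Real.log_one] at h
      nlinarith
    rw [if_neg this, if_neg this, mul_zero]
  · simp only [h1, if_false]
    split_ifs <;> ring

/-- **E2** for `weight B L`: for `0 < ε < 1/4` and large `U`,
`Σ_{(1-ε)U ≤ log n ≤ (1+ε)U} w_n ≤ 40 B ε`. [folklore] -/
lemma eventually_tsum_weight_window_le (ha : ∀ p : ℕ, p.Prime → |a p| ≤ B) {ε : ℝ}
    (hε : 0 < ε) (hε4 : ε < 1 / 4) :
    ∀ᶠ U : ℝ in atTop, ∑' n : ℕ,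
      (if (1 - ε) * U ≤ Real.log n ∧ Real.log n ≤ (1 + ε) * U then weight B L n else 0)
        ≤ 40 * B * ε := by
  filter_upwards [eventually_tsum_invPrimeWeight_window_le hε hε4, eventually_gt_atTop 0]
    with U hU hU0
  rw [show (fun n : ℕ =>
      (if (1 - ε) * U ≤ Real.log n ∧ Real.log n ≤ (1 + ε) * U then weight B L n else 0)) =
      fun n : ℕ => B * (if (1 - ε) * U ≤ Real.log n ∧ Real.log n ≤ (1 + ε) * U
        then invPrimeWeight n else 0) from funext (weight_window_eq (by linarith) hU0),
    tsum_mul_left]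
  calc B * ∑' n : ℕ, (if (1 - ε) * U ≤ Real.log n ∧ Real.log n ≤ (1 + ε) * U
        then invPrimeWeight n else 0) ≤ B * (40 * ε) :=
        mul_le_mul_of_nonneg_left hU (nonneg_of_bound ha)
    _ = 40 * B * ε := by ring

/-! ### The cut sums are the ordered prime sums -/

/-- For `x ≥ 1`: `Σ_{log n ≤ log x} c_n = -L + Σ_{p ≤ x} a(p)/p`. [folklore] -/
lemma tsum_coeff_cut_log {x : ℕ} (hx : 1 ≤ x) :
    ∑' n : ℕ, (if Real.log n ≤ Real.log x then coeff a L n else 0) =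
      -L + ∑ p ∈ Nat.primesLE x, a p / p := by
  have hx0 : (0 : ℝ) < x := by exact_mod_cast hx
  -- `log n ≤ log x ↔ n ≤ x` for all `n : ℕ` (both sides hold for `n = 0`)
  have hiff : ∀ n : ℕ, Real.log n ≤ Real.log x ↔ n ≤ x := by
    intro n
    rcases Nat.eq_zero_or_pos n with rfl | hn
    · simp [Real.log_nonneg (show (1 : ℝ) ≤ x by exact_mod_cast hx)]
    · rw [Real.log_le_log_iff (by exact_mod_cast hn) hx0, Nat.cast_le]
  rw [tsum_eq_sum (s := range (x + 1)) fun n hn => ?_]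
  · have h1 : ∑ n ∈ range (x + 1), (if Real.log n ≤ Real.log x then coeff a L n else 0) =
        ∑ n ∈ range (x + 1), (coeffOne L n + coeffP a n) := by
      refine sum_congr rfl fun n hn => ?_
      rw [if_pos ((hiff n).mpr (Nat.lt_succ_iff.mp (mem_range.mp hn))), coeff_eq_add]
    rw [h1, sum_add_distrib]
    congr 1
    · rw [sum_eq_single_of_mem 1 (mem_range.mpr (by omega)) fun n _ hn => by simp [coeffOne, hn]]
      simp [coeffOne]
    · rw [Nat.primesLE, Nat.primesBelow, sum_filter]
      refine sum_congr rfl fun n _ => ?_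
      by_cases hn : n.Prime
      · rw [if_pos hn, coeffP_of_prime hn]
      · rw [if_neg hn, coeffP_of_not_prime hn]
  · have hn' : ¬ n ≤ x := fun h => hn (mem_range.mpr (Nat.lt_succ_of_le h))
    rw [if_neg ((hiff n).not.mpr hn')]

/-! ### The theorem -/

/-- **Tauberian theorem for prime sums** (Hardy–Littlewood / Karamata; MV Thm. 5.11 with
`α = β = 0` for `Σ_p a(p) p^{-s}`, `a` bounded). If `|a p| ≤ B` on primes and
`Σ_p a(p) p^{-s} → L` as `s → 1⁺`, then `Σ_{p ≤ x} a(p)/p → L` as `x → ∞`.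
[cite: MontgomeryVaughan2007, Thm. 5.11] -/
theorem tendsto_sum_primesLE_div (ha : ∀ p : ℕ, p.Prime → |a p| ≤ B)
    (hL : Tendsto (fun s : ℝ => ∑' p : Nat.Primes, a p * (p : ℝ) ^ (-s)) (𝓝[>] 1) (𝓝 L)) :
    Tendsto (fun x : ℕ => ∑ p ∈ Nat.primesLE x, a p / p) atTop (𝓝 L) := by
  have hB := nonneg_of_bound ha
  -- the hypotheses of the Tauberian theorem
  have hlam : ∀ n : ℕ, 0 ≤ Real.log (n : ℝ) := fun n => Real.log_natCast_nonneg n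
  have hlim : Tendsto (fun δ : ℝ => δ ^ (0 : ℝ) *
      ∑' n, coeff a L n * Real.exp (-(δ * Real.log n))) (𝓝[>] 0) (𝓝 0) := by
    have h1 : Tendsto (fun δ : ℝ => 1 + δ) (𝓝[>] (0 : ℝ)) (𝓝[>] 1) := by
      refine tendsto_nhdsWithin_of_tendsto_nhds_of_eventually_within _ ?_ ?_
      · have : Tendsto (fun δ : ℝ => (1 : ℝ) + δ) (𝓝 0) (𝓝 (1 + 0)) :=
          tendsto_const_nhds.add tendsto_id
        rw [add_zero] at this
        exact this.mono_left nhdsWithin_le_nhds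
      · filter_upwards [self_mem_nhdsWithin] with δ (hδ : 0 < δ)
        show 1 < 1 + δ
        linarith
    have h2 : Tendsto (fun δ : ℝ => -L + ∑' p : Nat.Primes, a p * (p : ℝ) ^ (-(1 + δ)))
        (𝓝[>] 0) (𝓝 (-L + L)) := (hL.comp h1).const_add (-L)
    rw [neg_add_cancel] at h2
    refine h2.congr' ?_
    filter_upwards [self_mem_nhdsWithin] with δ (hδ : 0 < δ)
    rw [Real.rpow_zero, one_mul, tsum_coeff_mul_exp ha hδ]
  have hE1 : ∀ᶠ U : ℝ in atTop, ∑' n, weight B L n *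
      (Real.exp (-(Real.log n / U)) * (1 - Real.exp (-(Real.log n / U)))) ≤
        (40 * B) * U ^ (0 : ℝ) := by
    filter_upwards [eventually_ge_atTop 1] with U hU
    rw [Real.rpow_zero, mul_one]
    refine (tsum_weight_kernel_le ha hU).trans ?_
    nlinarith
  have hE2 : ∀ ε : ℝ, 0 < ε → ε < 1 / 4 → ∀ᶠ U : ℝ in atTop,
      ∑' n : ℕ, (if (1 - ε) * U ≤ Real.log n ∧ Real.log n ≤ (1 + ε) * U
        then weight B L n else 0) ≤ (40 * B) * ε * U ^ (0 : ℝ) := by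
    intro ε hε hε4
    filter_upwards [eventually_tsum_weight_window_le (L := L) ha hε hε4] with U hU
    rwa [Real.rpow_zero, mul_one]
  have key := HardyLittlewoodTauberianSums_holds (fun n : ℕ => Real.log n) (coeff a L)
    (weight B L) 0 (40 * B) le_rfl hlam (weight_nonneg ha) (neg_weight_le_coeff ha)
    (fun δ hδ => summable_coeff_mul_exp ha hδ) (fun δ hδ => summable_weight_mul_exp B L hδ)
    hlim hE1 hE2
  -- read off the conclusion along `U = log x`, `x : ℕ`
  have hlog : Tendsto (fun x : ℕ => Real.log (x : ℝ)) atTop atTop :=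
    Real.tendsto_log_atTop.comp tendsto_natCast_atTop_atTop
  have h3 := key.comp hlog
  have h4 : Tendsto (fun x : ℕ => -L + ∑ p ∈ Nat.primesLE x, a p / p) atTop (𝓝 0) := by
    refine h3.congr' ?_
    filter_upwards [eventually_ge_atTop 1] with x hx
    simp only [Function.comp_apply, Real.rpow_zero, div_one]
    exact tsum_coeff_cut_log hx
  have h5 := h4.const_add L
  simpa using h5

end PrimeSum

end Literature.NumberTheory.LFunctions
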